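import Literature.Geometry.Lorentzian.TeukolskyWhitingPotentialHorizon
import Literature.Geometry.Lorentzian.TeukolskyRealAxisModeStabilityProofs
import HarnessLib

/-!
# The end-game of §4.2: a solution of the transformed equation on `(r₊, ∞)` with the
# boundary behaviour of Prop. 3.8 vanishes (Teixeira da Costa 2020, §4.2, `s ≤ 0`, `|a| < M`)

Part of the proof programme for the named fact
`Literature.Geometry.Lorentzian.Kerr.Costa2019_realAxisModeStability` (R. Teixeira da Costa,
Commun. Math. Phys. 378 (2020) 705–781 = arXiv:1910.02854 [Costa2019], Thm. 4.1). This file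
assembles the printed argument of §4.2 ("The case `ω ∈ ℝ∖{0}`") in the variable `x ∈ (r₊, ∞)`:
let `G₀, G₁, G₂` (the Whiting transform of the amplitude of `R` on the real axis and its two
`x`-derivatives, constructed elsewhere) satisfy on `(r₊, ∞)`

* `G₀' = G₁`, `G₁' = G₂` and the tilde equation `Δ_x G₂ + P̃ G₁ + Q̃ G₀ = 0` (Prop. 3.8 (2));
* `G₀`, `G₁` bounded near `x = r₊` (Prop. 3.8 (3) at `x* → −∞`: `g̃` is `C¹` up to `x = r₊`);
* `|G₀|, |G₁| ≲ x^{s−1}` and `|G₁ − 2iω G₀| ≲ x^{s−2}` for large `x` (Lemma 3.14 / §3.2.3: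
  `|g̃| ≲ x^{s−1}`, `|g̃' − A(r₊−r₋) g̃| ≲ x^{s−2}`, `A(r₊−r₋) = 2iω`).

Then `G₀ ≡ 0` (`Costa2019.tildeSolution_eq_zero`). Proof as printed: `ũ = μ G₀` (the Liouville
factor `μ` of `TeukolskyWhitingOperator.lean`) pulled back along a tortoise radius function
`x = R(x*)` is a bounded `C²` solution `v` of `v'' + Ṽ v = 0` on `x* ∈ ℝ`
(`Costa2019.transformed_equation_tortoise`) with `Ṽ` real, `Ṽ(x*) → ω₀² = ω²(r₊−r₋)²/r₊²` at an
integrable rate as `x* → −∞` (`Costa2019.whitingPotential_sub_sq_le`,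
`Costa2019.intervalIntegral_abs_comp_tortoise_le`), `v' + iω₀ v → 0` at `−∞` (because
`h → 0` and `hν → −iω₀` at `x = r₊`, `h = Δ/(x²+a²)`, `ν = μ'/μ`) and `v' − iω v → 0` at `+∞`
(because `h → 1`, `hν → −iω`, `|μ| ≲ x^{1−s}`); the conserved `T`-current and the unique
continuation lemma (`Costa2019.transformedSolution_eq_zero`, Lemma 4.1) give `v ≡ 0`, and
`μ ≠ 0`, `R` onto `(r₊, ∞)` give `G₀ ≡ 0`. Everything is proved; theorems only (D-0026).

## References
* R. Teixeira da Costa, CMP 378 (2020) 705–781, arXiv:1910.02854, Prop. 3.8, Remark 3.9,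
  Lemma 4.1, §4.2. [Costa2019]
-/

noncomputable section

open Complex Set Filter Topology MeasureTheory

namespace Literature.Geometry.Lorentzian.Kerr

namespace Costa2019

/-! ### A boundedness principle on the line -/

/-- A continuous function on `ℝ` which is eventually bounded at `−∞` and at `+∞` is bounded.
[folklore] -/
theorem exists_bound_of_continuous_of_eventually {f : ℝ → ℂ} (hf : Continuous f) {B₁ B₂ : ℝ}
    (h₁ : ∀ᶠ t in atBot, ‖f t‖ ≤ B₁) (h₂ : ∀ᶠ t in atTop, ‖f t‖ ≤ B₂) :
    ∃ B, ∀ t, ‖f t‖ ≤ B := by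
  obtain ⟨t₁, ht₁⟩ := Filter.eventually_atBot.1 h₁
  obtain ⟨t₂, ht₂⟩ := Filter.eventually_atTop.1 h₂
  obtain ⟨B₀, hB₀⟩ :=
    (isCompact_Icc (a := t₁) (b := t₂)).exists_bound_of_continuousOn hf.norm.continuousOn
  refine ⟨max B₀ (max B₁ B₂), fun t => ?_⟩
  rcases le_or_gt t t₁ with h | h
  · exact (ht₁ t h).trans ((le_max_left _ _).trans (le_max_right _ _))
  rcases le_or_gt t₂ t with h' | h'
  · exact (ht₂ t h').trans ((le_max_right _ _).trans (le_max_right _ _))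
  · have := hB₀ t ⟨h.le, h'.le⟩
    rw [Real.norm_eq_abs, abs_of_nonneg (norm_nonneg _)] at this
    exact this.trans (le_max_left _ _)

/-! ### Sizes of the Liouville factor `μ` -/

/-- `|μ(x)| = √(x² + a²) (x − r₋)^{−s}` for `x > r₊` (real `ω`). [cite: Costa2019, §3.2.4] -/
theorem norm_liouvilleMu {M a : ℝ} (s ω : ℝ) {x : ℝ} (hr : rPlus M a < x) :
    ‖liouvilleMu M a s ω x‖ = Real.sqrt (x ^ 2 + a ^ 2) * (x - rMinus M a) ^ (-s) := by
  have hq : rMinus M a < x := (rMinus_le_rPlus M a).trans_lt hr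
  unfold liouvilleMu
  rw [norm_mul, norm_mul, norm_mul, Complex.norm_real, Real.norm_eq_abs,
    abs_of_nonneg (Real.sqrt_nonneg _), Complex.norm_cpow_eq_rpow_re_of_pos (sub_pos.2 hq),
    Complex.norm_cpow_eq_rpow_re_of_pos (sub_pos.2 hr), Complex.norm_exp]
  simp [Complex.neg_re, Complex.mul_re, Complex.I_re, Complex.I_im, Complex.ofReal_re,
    Complex.ofReal_im]

/-- Near the horizon (`s ≤ 0`): `|μ(x)| ≤ √((r₊+1)² + a²) (r₊ + 1 − r₋)^{−s}` for
`r₊ < x ≤ r₊ + 1`. [cite: Costa2019, Prop. 3.8 (3)] -/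
theorem norm_liouvilleMu_le_near {M a : ℝ} (hM : 0 < M) {s : ℝ} (hs : s ≤ 0) (ω : ℝ) {x : ℝ}
    (hr : rPlus M a < x) (hx : x ≤ rPlus M a + 1) :
    ‖liouvilleMu M a s ω x‖ ≤
      Real.sqrt ((rPlus M a + 1) ^ 2 + a ^ 2) * (rPlus M a + 1 - rMinus M a) ^ (-s) := by
  have hq : rMinus M a < x := (rMinus_le_rPlus M a).trans_lt hr
  have hx0 : 0 < x := (rPlus_pos hM a).trans hr
  rw [norm_liouvilleMu s ω hr]
  refine mul_le_mul ?_ ?_ (Real.rpow_nonneg (sub_pos.2 hq).le _) (Real.sqrt_nonneg _)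
  · exact Real.sqrt_le_sqrt (by nlinarith)
  · exact Real.rpow_le_rpow (sub_pos.2 hq).le (by linarith) (by linarith)

/-- Far away (`s ≤ 0`, so `r₋ ≥ 0` is used through `(x − r₋)^{−s} ≤ x^{−s}`):
`|μ(x)| ≤ 2 x^{1−s}` for `x > r₊`, `x ≥ |a|`. [cite: Costa2019, Prop. 3.8 (3)] -/
theorem norm_liouvilleMu_le_far {M a : ℝ} (ha : |a| < M) {s : ℝ} (hs : s ≤ 0) (ω : ℝ) {x : ℝ}
    (hr : rPlus M a < x) (hxa : |a| ≤ x) :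
    ‖liouvilleMu M a s ω x‖ ≤ 2 * x ^ (1 - s) := by
  have hq : rMinus M a < x := (rMinus_le_rPlus M a).trans_lt hr
  have hx0 : 0 < x := (rPlus_pos (IsSubextremal.pos ha) a).trans hr
  have hr0 : 0 ≤ rMinus M a := IsSubextremal.rMinus_nonneg ha
  rw [norm_liouvilleMu s ω hr]
  have h1 : Real.sqrt (x ^ 2 + a ^ 2) ≤ 2 * x := by
    have ha2 : a ^ 2 ≤ x ^ 2 := by
      have := sq_le_sq' (neg_le_of_abs_le hxa) (le_of_abs_le hxa)
      simpa using this
    calc Real.sqrt (x ^ 2 + a ^ 2) ≤ Real.sqrt ((2 * x) ^ 2) := Real.sqrt_le_sqrt (by nlinarith)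
      _ = 2 * x := Real.sqrt_sq (by linarith)
  have h2 : (x - rMinus M a) ^ (-s) ≤ x ^ (-s) :=
    Real.rpow_le_rpow (sub_pos.2 hq).le (by linarith) (by linarith)
  calc Real.sqrt (x ^ 2 + a ^ 2) * (x - rMinus M a) ^ (-s) ≤ (2 * x) * x ^ (-s) :=
        mul_le_mul h1 h2 (Real.rpow_nonneg (sub_pos.2 hq).le _) (by linarith)
    _ = 2 * x ^ (1 - s) := by
        rw [show (1 : ℝ) - s = 1 + -s by ring, Real.rpow_add hx0, Real.rpow_one]; ring

/-! ### The tortoise factor `h` and the product `h ν` -/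

/-- `0 < h(x) ≤ 1` for `x > r₊` (`h = Δ/(x²+a²) = 1 − 2Mx/(x²+a²)`). [cite: Costa2019, Prop. 3.8] -/
theorem tortoiseH_pos_le_one {M a : ℝ} (hM : 0 < M) (ha : |a| < M) {x : ℝ} (hr : rPlus M a < x) :
    0 < tortoiseH M a x ∧ tortoiseH M a x ≤ 1 := by
  have hx0 : 0 < x := (rPlus_pos hM a).trans hr
  have hX : 0 < x ^ 2 + a ^ 2 := by positivity
  have hΔ : 0 < delta M a x := delta_pos ha.le hr
  unfold tortoiseH
  refine ⟨div_pos hΔ hX, (div_le_one hX).2 ?_⟩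
  unfold delta
  nlinarith

/-- `|h(x) − 1| ≤ 2M/x` for `x > r₊`. [cite: Costa2019, Prop. 3.8] -/
theorem abs_tortoiseH_sub_one_le {M a : ℝ} (hM : 0 < M) {x : ℝ} (hr : rPlus M a < x) :
    |tortoiseH M a x - 1| ≤ 2 * M / x := by
  have hx0 : 0 < x := (rPlus_pos hM a).trans hr
  have hX : 0 < x ^ 2 + a ^ 2 := by positivity
  have h1 : tortoiseH M a x - 1 = -(2 * M * x / (x ^ 2 + a ^ 2)) := by
    unfold tortoiseH delta
    field_simp
    ring
  rw [h1, abs_neg, abs_of_nonneg (by positivity)]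
  rw [div_le_div_iff₀ hX hx0]
  nlinarith

/-- **Regular form of `h ν` across the horizon.** For `x > r₊`,
`h ν = [Δ/(x²+a²)]·[x/(x²+a²) − s/(x−r₋) − iω] − 2iMω (x − r₋)/(x²+a²)` (the pole of `ν` at
`r₊` is cancelled by `Δ`). [cite: Costa2019, §3.2.4] -/
theorem tortoiseH_mul_liouvilleNu {M a : ℝ} (hM : 0 < M) (ha : |a| < M) (s ω : ℝ) {x : ℝ}
    (hr : rPlus M a < x) :
    (tortoiseH M a x : ℂ) * liouvilleNu M a s ω x =
      ((delta M a x / (x ^ 2 + a ^ 2) : ℝ) : ℂ) *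
          ((x : ℂ) / ((x ^ 2 + a ^ 2 : ℝ) : ℂ) - (s : ℂ) / ((x - rMinus M a : ℝ) : ℂ) - I * ω) -
        2 * I * M * ω * ((x - rMinus M a : ℝ) : ℂ) / ((x ^ 2 + a ^ 2 : ℝ) : ℂ) := by
  have hx0 : 0 < x := (rPlus_pos hM a).trans hr
  have hq : rMinus M a < x := (rMinus_le_rPlus M a).trans_lt hr
  have hp : (x : ℂ) - (rPlus M a : ℂ) ≠ 0 := by
    rw [← Complex.ofReal_sub]; exact_mod_cast (sub_pos.2 hr).ne'
  have hq' : (x : ℂ) - (rMinus M a : ℂ) ≠ 0 := by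
    rw [← Complex.ofReal_sub]; exact_mod_cast (sub_pos.2 hq).ne'
  have hX : (x : ℂ) ^ 2 + (a : ℂ) ^ 2 ≠ 0 := by
    have h : x ^ 2 + a ^ 2 ≠ 0 := by positivity
    exact_mod_cast h
  unfold tortoiseH liouvilleNu
  rw [delta_eq_mul ha.le]
  push_cast
  field_simp
  ring

/-- **`h ν → −iω₀` at the horizon**, `ω₀ = ω(r₊ − r₋)/r₊` (from the regular form and
`r₊² + a² = 2Mr₊`): `h ν + iω₀ → 0` as `x → r₊⁺`. This is why `ũ' + iω₀ ũ → 0` at `x* → −∞`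
(Prop. 3.8 (4)). [cite: Costa2019, Prop. 3.8 (4), §4.2] -/
theorem tendsto_tortoiseH_mul_liouvilleNu_horizon {M a : ℝ} (hM : 0 < M) (ha : |a| < M)
    (s ω : ℝ) :
    Tendsto (fun x => (tortoiseH M a x : ℂ) * liouvilleNu M a s ω x +
        I * ((ω * (rPlus M a - rMinus M a) / rPlus M a : ℝ) : ℂ))
      (𝓝[>] rPlus M a) (𝓝 0) := by
  have hrp : 0 < rPlus M a := rPlus_pos hM a
  have hgap : 0 < rPlus M a - rMinus M a := sub_pos.2 (IsSubextremal.rMinus_lt_rPlus ha)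
  have hA : rPlus M a ^ 2 + a ^ 2 = 2 * M * rPlus M a := rPlus_sq_add_sq ha.le
  -- the regular expression, as a function of `x`
  set reg : ℝ → ℂ := fun x => ((delta M a x / (x ^ 2 + a ^ 2) : ℝ) : ℂ) *
      ((x : ℂ) / ((x ^ 2 + a ^ 2 : ℝ) : ℂ) - (s : ℂ) / ((x - rMinus M a : ℝ) : ℂ) - I * ω) -
    2 * I * M * ω * ((x - rMinus M a : ℝ) : ℂ) / ((x ^ 2 + a ^ 2 : ℝ) : ℂ) with hreg
  have hcont : ContinuousAt reg (rPlus M a) := by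
    have hX : ((rPlus M a ^ 2 + a ^ 2 : ℝ) : ℂ) ≠ 0 := by
      have : (0 : ℝ) < rPlus M a ^ 2 + a ^ 2 := by positivity
      exact_mod_cast this.ne'
    have hq : ((rPlus M a - rMinus M a : ℝ) : ℂ) ≠ 0 := by exact_mod_cast hgap.ne'
    have c1 : ContinuousAt (fun x : ℝ => ((delta M a x / (x ^ 2 + a ^ 2) : ℝ) : ℂ)) (rPlus M a) := by
      refine Complex.continuous_ofReal.continuousAt.comp ?_
      refine (hasDerivAt_delta M a (rPlus M a)).continuousAt.div ?_ (by positivity)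
      exact ((continuous_id.pow 2).add continuous_const).continuousAt
    have c2 : ContinuousAt (fun x : ℝ => ((x ^ 2 + a ^ 2 : ℝ) : ℂ)) (rPlus M a) :=
      Complex.continuous_ofReal.continuousAt.comp
        ((continuous_id.pow 2).add continuous_const).continuousAt
    have c3 : ContinuousAt (fun x : ℝ => ((x - rMinus M a : ℝ) : ℂ)) (rPlus M a) :=
      Complex.continuous_ofReal.continuousAt.comp (continuous_id.sub continuous_const).continuousAt
    have c4 : ContinuousAt (fun x : ℝ => (x : ℂ)) (rPlus M a) :=
      Complex.continuous_ofReal.continuousAt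
    simp only [hreg]
    exact (c1.mul (((c4.div c2 hX).sub (continuousAt_const.div c3 hq)).sub continuousAt_const)).sub
      (((continuousAt_const.mul c3)).div c2 hX)
  have hval : reg (rPlus M a) + I * ((ω * (rPlus M a - rMinus M a) / rPlus M a : ℝ) : ℂ) = 0 := by
    simp only [hreg, delta_rPlus ha.le, zero_div]
    have h1 : ((rPlus M a ^ 2 + a ^ 2 : ℝ) : ℂ) = 2 * M * rPlus M a := by
      rw [hA]; push_cast; ring
    rw [h1]
    have hMc : (M : ℂ) ≠ 0 := by exact_mod_cast hM.ne'
    have hrc : (rPlus M a : ℂ) ≠ 0 := by exact_mod_cast hrp.ne'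
    push_cast
    field_simp
    ring
  have hlim : Tendsto (fun x => reg x + I * ((ω * (rPlus M a - rMinus M a) / rPlus M a : ℝ) : ℂ))
      (𝓝[>] rPlus M a) (𝓝 0) := by
    rw [← hval]
    exact ((hcont.add continuousAt_const).tendsto).mono_left nhdsWithin_le_nhds
  refine hlim.congr' ?_
  filter_upwards [self_mem_nhdsWithin] with x hx
  simp only [hreg]
  rw [tortoiseH_mul_liouvilleNu hM ha s ω hx]

/-- `h(x) → 0` as `x → r₊⁺`. [cite: Costa2019, Prop. 3.8] -/
theorem tendsto_tortoiseH_horizon {M a : ℝ} (hM : 0 < M) (ha : |a| < M) :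
    Tendsto (fun x => (tortoiseH M a x : ℂ)) (𝓝[>] rPlus M a) (𝓝 0) := by
  have hrp : 0 < rPlus M a := rPlus_pos hM a
  have hc : ContinuousAt (tortoiseH M a) (rPlus M a) := by
    refine (hasDerivAt_delta M a (rPlus M a)).continuousAt.div ?_ (by positivity)
    exact ((continuous_id.pow 2).add continuous_const).continuousAt
  have h0 : tortoiseH M a (rPlus M a) = 0 := by
    unfold tortoiseH; rw [delta_rPlus ha.le, zero_div]
  have h1 : Tendsto (fun x => (tortoiseH M a x : ℂ)) (𝓝 (rPlus M a)) (𝓝 0) := by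
    have := (Complex.continuous_ofReal.continuousAt.comp hc).tendsto
    simpa [Function.comp_def, h0] using this
  exact h1.mono_left nhdsWithin_le_nhds

/-- **`h ν + iω = O(1/x)` at infinity** (so that `hν → −iω`, `h → 1`: `ũ' − iω ũ → 0` reduces to
`|G₁ − 2iωG₀| ≲ x^{s−2}`): for `x ≥ 2r₊`,
`‖h ν + iω‖ ≤ (1 + 2|s| + 6M|ω|)/x`. [cite: Costa2019, Prop. 3.8 (4), Lemma 3.14] -/
theorem norm_tortoiseH_mul_liouvilleNu_add_le {M a : ℝ} (hM : 0 < M) (ha : |a| < M) (s ω : ℝ)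
    {x : ℝ} (hx : 2 * rPlus M a ≤ x) :
    ‖(tortoiseH M a x : ℂ) * liouvilleNu M a s ω x + I * ω‖ ≤
      (1 + 2 * |s| + 6 * M * |ω|) / x := by
  have hrp : 0 < rPlus M a := rPlus_pos hM a
  have hr : rPlus M a < x := by linarith
  have hx0 : 0 < x := hrp.trans hr
  have hq : rMinus M a < x := (rMinus_le_rPlus M a).trans_lt hr
  have hxp : x / 2 ≤ x - rPlus M a := by linarith
  have hxq : x / 2 ≤ x - rMinus M a := by linarith [rMinus_le_rPlus M a]
  obtain ⟨hh0, hh1⟩ := tortoiseH_pos_le_one hM ha hr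
  have hh : |tortoiseH M a x| ≤ 1 := by rw [abs_of_pos hh0]; exact hh1
  -- `hν + iω = h (x/(x²+a²) − s/(x−r₋) − 2iMω/(x−r₊)) + iω(1 − h)`
  have hsplit : (tortoiseH M a x : ℂ) * liouvilleNu M a s ω x + I * ω =
      (tortoiseH M a x : ℂ) * ((x : ℂ) / ((x ^ 2 + a ^ 2 : ℝ) : ℂ) -
          (s : ℂ) / ((x - rMinus M a : ℝ) : ℂ) - 2 * I * M * ω / ((x - rPlus M a : ℝ) : ℂ)) +
        I * ω * (1 - (tortoiseH M a x : ℂ)) := by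
    unfold liouvilleNu; ring
  rw [hsplit]
  have hX : (0 : ℝ) < x ^ 2 + a ^ 2 := by positivity
  have t1 : ‖(x : ℂ) / ((x ^ 2 + a ^ 2 : ℝ) : ℂ)‖ ≤ 1 / x := by
    rw [norm_div, Complex.norm_real, Complex.norm_real, Real.norm_eq_abs, Real.norm_eq_abs,
      abs_of_pos hx0, abs_of_pos hX, div_le_div_iff₀ hX hx0]
    nlinarith [sq_nonneg a]
  have t2 : ‖(s : ℂ) / ((x - rMinus M a : ℝ) : ℂ)‖ ≤ 2 * |s| / x := by
    rw [norm_div, Complex.norm_real, Complex.norm_real, Real.norm_eq_abs, Real.norm_eq_abs,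
      abs_of_pos (sub_pos.2 hq), div_le_div_iff₀ (sub_pos.2 hq) hx0]
    nlinarith [abs_nonneg s]
  have t3 : ‖2 * I * M * ω / ((x - rPlus M a : ℝ) : ℂ)‖ ≤ 4 * M * |ω| / x := by
    rw [norm_div, Complex.norm_real, Real.norm_eq_abs, abs_of_pos (sub_pos.2 hr)]
    have : ‖(2 * I * M * ω : ℂ)‖ = 2 * M * |ω| := by
      rw [norm_mul, norm_mul, norm_mul, Complex.norm_I, Complex.norm_real, Complex.norm_real,
        Real.norm_eq_abs, Real.norm_eq_abs, abs_of_pos hM]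
      norm_num
    rw [this, div_le_div_iff₀ (sub_pos.2 hr) hx0]
    have : 0 ≤ M * |ω| := by positivity
    nlinarith
  have t4 : ‖I * ω * (1 - (tortoiseH M a x : ℂ))‖ ≤ 2 * M * |ω| / x := by
    rw [norm_mul, norm_mul, Complex.norm_I, one_mul, Complex.norm_real, Real.norm_eq_abs,
      ← Complex.ofReal_one, ← Complex.ofReal_sub, Complex.norm_real, Real.norm_eq_abs,
      abs_sub_comm]
    have := abs_tortoiseH_sub_one_le hM hr (a := a)
    calc |ω| * |tortoiseH M a x - 1| ≤ |ω| * (2 * M / x) :=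
          mul_le_mul_of_nonneg_left this (abs_nonneg ω)
      _ = 2 * M * |ω| / x := by ring
  have hhn : ‖(tortoiseH M a x : ℂ)‖ ≤ 1 := by
    rw [Complex.norm_real, Real.norm_eq_abs]; exact hh
  calc ‖(tortoiseH M a x : ℂ) * ((x : ℂ) / ((x ^ 2 + a ^ 2 : ℝ) : ℂ) -
          (s : ℂ) / ((x - rMinus M a : ℝ) : ℂ) - 2 * I * M * ω / ((x - rPlus M a : ℝ) : ℂ)) +
        I * ω * (1 - (tortoiseH M a x : ℂ))‖ ≤
      1 * (1 / x + 2 * |s| / x + 4 * M * |ω| / x) + 2 * M * |ω| / x := by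
        refine (norm_add_le _ _).trans (add_le_add ?_ t4)
        rw [norm_mul]
        refine mul_le_mul hhn ?_ (norm_nonneg _) zero_le_one
        exact (norm_sub_le _ _).trans (add_le_add ((norm_sub_le _ _).trans (add_le_add t1 t2)) t3)
    _ = (1 + 2 * |s| + 6 * M * |ω|) / x := by ring

/-! ### Surjectivity of tortoise radius functions -/

/-- A tortoise radius function takes every value in `(r₊, ∞)`. [cite: DafermosRodnianskiShlapentokhrothman2014, §2.1.2] -/
theorem tortoise_exists_eq {M a : ℝ} {R : ℝ → ℝ} (hR : IsTortoiseRadius M a R) {x : ℝ}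
    (hx : rPlus M a < x) : ∃ t, R t = x := by
  have h1 : ∀ᶠ t in atBot, R t < x := hR.tendsto_atBot (Iio_mem_nhds hx)
  have h2 : ∀ᶠ t in atTop, x ≤ R t := hR.eventually_le x
  obtain ⟨t₁, ht₁⟩ := h1.exists
  obtain ⟨t₂, ht₂⟩ := h2.exists
  have hI := intermediate_value_univ t₁ t₂ (f := R) hR.continuous
  exact hI ⟨ht₁.le, ht₂⟩

/-- A tortoise radius function tends to `r₊` *from the right* at `−∞`. [folklore] -/
theorem tendsto_tortoise_atBot_nhdsWithin {M a : ℝ} {R : ℝ → ℝ}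
    (hR : IsTortoiseRadius M a R) : Tendsto R atBot (𝓝[>] rPlus M a) :=
  tendsto_nhdsWithin_iff.2 ⟨hR.tendsto_atBot, Eventually.of_forall fun t => hR.rPlus_lt t⟩

/-! ### The end-game -/

/-- **Teixeira da Costa §4.2, the case `ω ∈ ℝ∖{0}`, `|a| < M`, `s ≤ 0` — assembled.** Let
`G₀, G₁, G₂ : ℝ → ℂ` satisfy on `(r₊, ∞)`: `G₀' = G₁`, `G₁' = G₂`, the tilde equation
`Δ_x G₂ + P̃(x) G₁ + Q̃(x) G₀ = 0`; `G₀, G₁` bounded near `r₊`; and for large `x`,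
`|G₀|, |G₁| ≤ C x^{s−1}`, `|G₁ − 2iω G₀| ≤ C x^{s−2}`. Then `G₀ ≡ 0` on `(r₊, ∞)`.
(Prop. 3.8 (2)–(4) feed the `T`-current argument and Lemma 4.1 through
`Costa2019.transformedSolution_eq_zero`, along a tortoise radius function.)
[cite: Costa2019, §4.2 (proof of Theorem 4.1 for s ≤ 0, ω real, |a| < M), Prop. 3.8, Lemma 4.1] -/
theorem tildeSolution_eq_zero {M a : ℝ} (hM : 0 < M) (ha : |a| < M) {s : ℝ} (hs : s ≤ 0)
    {ω : ℝ} (hω : ω ≠ 0) (m lam : ℝ) {G₀ G₁ G₂ : ℝ → ℂ}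
    (hG₀ : ∀ x, rPlus M a < x → HasDerivAt G₀ (G₁ x) x)
    (hG₁ : ∀ x, rPlus M a < x → HasDerivAt G₁ (G₂ x) x)
    (hT : ∀ x, rPlus M a < x →
      (delta M a x : ℂ) * G₂ x + heunPt M a s ω m x * G₁ x + heunQt M a s ω m lam x * G₀ x = 0)
    (hnear : ∃ δ B : ℝ, 0 < δ ∧ ∀ x ∈ Ioo (rPlus M a) (rPlus M a + δ), ‖G₀ x‖ ≤ B ∧ ‖G₁ x‖ ≤ B)
    (hfar : ∃ X C : ℝ, ∀ x, X ≤ x →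
      ‖G₀ x‖ ≤ C * x ^ (s - 1) ∧ ‖G₁ x‖ ≤ C * x ^ (s - 1) ∧
        ‖G₁ x - 2 * I * ω * G₀ x‖ ≤ C * x ^ (s - 2)) :
    ∀ x, rPlus M a < x → G₀ x = 0 := by
  have hMa : IsSubextremal M a := ha
  have hrp : 0 < rPlus M a := rPlus_pos hM a
  have hgap : 0 < rPlus M a - rMinus M a := sub_pos.2 (IsSubextremal.rMinus_lt_rPlus ha)
  obtain ⟨R, hR⟩ := exists_isTortoiseRadius hMa
  obtain ⟨δ, B, hδ, hB⟩ := hnear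
  obtain ⟨X, C, hC⟩ := hfar
  -- the integrable rate of `Ṽ − ω₀²` at the horizon and the limits of `h`, `hν` there
  obtain ⟨x₁, L, hx₁, hL, hVle⟩ := whitingPotential_sub_sq_le hM ha s ω m lam
  have hlimhν := tendsto_tortoiseH_mul_liouvilleNu_horizon hM ha s ω
  have hlimh := tendsto_tortoiseH_horizon hM ha
  set ω₀ : ℝ := ω * (rPlus M a - rMinus M a) / rPlus M a with hω₀
  -- the pulled-back functions
  set W : ℝ → ℝ := fun t => whitingPotential M a s ω m lam (R t) with hW
  set v : ℝ → ℂ := fun t => liouvilleMu M a s ω (R t) * G₀ (R t) with hv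
  set v' : ℝ → ℂ := fun t => (tortoiseH M a (R t) : ℂ) *
    (liouvilleMu M a s ω (R t) * (G₁ (R t) + liouvilleNu M a s ω (R t) * G₀ (R t))) with hv'
  set v'' : ℝ → ℂ := fun t => -(W t : ℂ) * v t with hv''
  -- the equation along the tortoise coordinate
  have hderiv : ∀ t, HasDerivAt v (v' t) t ∧ HasDerivAt v' (v'' t) t := by
    intro t
    have hr := hR.rPlus_lt t
    obtain ⟨v₂, h1, h2, h3⟩ := transformed_equation_tortoise hM ha s ω m lam hR
      (hG₀ (R t) hr) (hG₁ (R t) hr) (hT (R t) hr)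
    have hv₂ : v₂ = v'' t := by
      simp only [hv'', hW, hv]
      linear_combination h3
    exact ⟨h1, hv₂ ▸ h2⟩
  have hode : ∀ t, v'' t + (W t : ℂ) * v t = 0 := fun t => by simp only [hv'']; ring
  have hWc : Continuous W :=
    (continuousOn_whitingPotential hM ha s ω m lam).comp_continuous hR.continuous hR.rPlus_lt
  have hvc : Continuous v := continuous_iff_continuousAt.2 fun t => (hderiv t).1.continuousAt
  have hv'c : Continuous v' := continuous_iff_continuousAt.2 fun t => (hderiv t).2.continuousAt
  -- `ω ω₀ > 0`
  have hωω₀ : 0 < ω * ω₀ := by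
    have hω2 : 0 < ω ^ 2 := lt_of_le_of_ne (sq_nonneg ω) (Ne.symm (pow_ne_zero 2 hω))
    have : ω * ω₀ = ω ^ 2 * ((rPlus M a - rMinus M a) / rPlus M a) := by rw [hω₀]; ring
    rw [this]
    exact mul_pos hω2 (div_pos hgap hrp)
  -- the integrable rate at `x* → −∞`
  have hFc : ContinuousOn (fun x => whitingPotential M a s ω m lam x - ω₀ ^ 2)
      (Ioi (rPlus M a)) :=
    (continuousOn_whitingPotential hM ha s ω m lam).sub continuousOn_const
  obtain ⟨t₀, ht₀⟩ : ∃ t₀, R t₀ ≤ x₁ := by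
    have h1 : ∀ᶠ t in atBot, R t < x₁ := hR.tendsto_atBot (Iio_mem_nhds hx₁)
    obtain ⟨t₀, ht₀⟩ := h1.exists
    exact ⟨t₀, ht₀.le⟩
  have hint : ∀ t, t ≤ t₀ → ∫ τ in t..t₀, |ω₀ ^ 2 - W τ| ≤
      L * ((x₁ ^ 2 + a ^ 2) / (rPlus M a - rMinus M a)) * (x₁ - rPlus M a) := by
    intro t ht
    have h1 := intervalIntegral_abs_comp_tortoise_le hMa hR hL hFc
      (fun x hx hx' => hVle x hx hx') ht₀ ht
    have h2 : (fun τ => |ω₀ ^ 2 - W τ|) =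
        fun τ => |whitingPotential M a s ω m lam (R τ) - ω₀ ^ 2| := by
      funext τ; rw [abs_sub_comm]
    rw [h2]
    exact h1
  -- transport of neighbourhoods of `r₊⁺` and of `+∞` along `R`
  have hRbot := tendsto_tortoise_atBot_nhdsWithin hR
  have hδ1 : 0 < min δ 1 := lt_min hδ one_pos
  have hev_near : ∀ᶠ t in atBot, R t ∈ Ioo (rPlus M a) (rPlus M a + min δ 1) :=
    hRbot (Ioo_mem_nhdsGT (by linarith))
  have hev_hν : ∀ᶠ t in atBot,
      ‖(tortoiseH M a (R t) : ℂ) * liouvilleNu M a s ω (R t) + I * (ω₀ : ℂ)‖ < 1 := by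
    have h1 : ∀ᶠ x in 𝓝[>] rPlus M a,
        ‖(tortoiseH M a x : ℂ) * liouvilleNu M a s ω x + I * (ω₀ : ℂ)‖ < 1 := by
      have h2 := hlimhν (Metric.ball_mem_nhds (0 : ℂ) one_pos)
      filter_upwards [h2] with x hx
      simpa using hx
    exact hRbot.eventually h1
  set X' : ℝ := max X (max (2 * rPlus M a) (max |a| 1)) with hX'
  have hev_far : ∀ᶠ t in atTop, X' ≤ R t := hR.eventually_le X'
  have hX'X : X ≤ X' := le_max_left _ _
  have hX'2 : 2 * rPlus M a ≤ X' := (le_max_left _ _).trans (le_max_right _ _)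
  have hX'a : |a| ≤ X' := ((le_max_left _ _).trans (le_max_right _ _)).trans (le_max_right _ _)
  have hX'1 : 1 ≤ X' := ((le_max_right _ _).trans (le_max_right _ _)).trans (le_max_right _ _)
  -- constants
  set Bμ : ℝ := Real.sqrt ((rPlus M a + 1) ^ 2 + a ^ 2) * (rPlus M a + 1 - rMinus M a) ^ (-s)
    with hBμ
  have hBμ0 : 0 ≤ Bμ := mul_nonneg (Real.sqrt_nonneg _) (Real.rpow_nonneg (by linarith) _)
  set C₁ : ℝ := 1 + 2 * |s| + 6 * M * |ω| with hC₁
  have hC₁0 : 0 ≤ C₁ := by positivity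
  -- power bookkeeping
  have hpow1 : ∀ x : ℝ, 0 < x → x ^ (1 - s) * x ^ (s - 1) = 1 := fun x hx => by
    rw [← Real.rpow_add hx, show (1 - s) + (s - 1) = (0 : ℝ) by ring, Real.rpow_zero]
  have hpow2 : ∀ x : ℝ, 0 < x → x ^ (1 - s) * x ^ (s - 2) = x⁻¹ := fun x hx => by
    rw [← Real.rpow_add hx, show (1 - s) + (s - 2) = (-1 : ℝ) by ring, Real.rpow_neg_one]
  have hpow3 : ∀ x : ℝ, 0 < x → x ^ (s - 1) / x = x ^ (s - 2) := fun x hx => by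
    rw [div_eq_mul_inv, ← Real.rpow_neg_one x, ← Real.rpow_add hx,
      show s - 1 + (-1) = s - 2 by ring]
  -- NEAR THE HORIZON (`t → −∞`): bounds and the limit `v' + iω₀ v → 0`
  have hnear_all : ∀ᶠ t in atBot, ‖v t‖ ≤ Bμ * B ∧ ‖v' t‖ ≤ Bμ * (B + (1 + |ω₀|) * B) ∧
      ‖v' t + I * ω₀ * v t‖ ≤ Bμ * (‖(tortoiseH M a (R t) : ℂ)‖ * B +
        ‖(tortoiseH M a (R t) : ℂ) * liouvilleNu M a s ω (R t) + I * (ω₀ : ℂ)‖ * B) := by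
    filter_upwards [hev_near, hev_hν] with t ht hthν
    have hr : rPlus M a < R t := ht.1
    have hx1 : R t ≤ rPlus M a + 1 := by linarith [ht.2, min_le_right δ 1]
    have hxδ : R t ∈ Ioo (rPlus M a) (rPlus M a + δ) := ⟨hr, by linarith [ht.2, min_le_left δ 1]⟩
    obtain ⟨hG₀B, hG₁B⟩ := hB (R t) hxδ
    have hμ : ‖liouvilleMu M a s ω (R t)‖ ≤ Bμ := norm_liouvilleMu_le_near hM hs ω hr hx1
    obtain ⟨hh0, hh1⟩ := tortoiseH_pos_le_one hM ha hr
    have hhn : ‖(tortoiseH M a (R t) : ℂ)‖ ≤ 1 := by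
      rw [Complex.norm_real, Real.norm_eq_abs, abs_of_pos hh0]; exact hh1
    have hhν : ‖(tortoiseH M a (R t) : ℂ) * liouvilleNu M a s ω (R t)‖ ≤ 1 + |ω₀| := by
      have e : (tortoiseH M a (R t) : ℂ) * liouvilleNu M a s ω (R t) =
          ((tortoiseH M a (R t) : ℂ) * liouvilleNu M a s ω (R t) + I * (ω₀ : ℂ)) - I * (ω₀ : ℂ) := by
        ring
      rw [e]
      refine (norm_sub_le _ _).trans (add_le_add hthν.le ?_)
      rw [norm_mul, Complex.norm_I, one_mul, Complex.norm_real, Real.norm_eq_abs]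
    refine ⟨?_, ?_, ?_⟩
    · simp only [hv, norm_mul]
      exact mul_le_mul hμ hG₀B (norm_nonneg _) hBμ0
    · have e : v' t = liouvilleMu M a s ω (R t) * ((tortoiseH M a (R t) : ℂ) * G₁ (R t) +
          ((tortoiseH M a (R t) : ℂ) * liouvilleNu M a s ω (R t)) * G₀ (R t)) := by
        simp only [hv']; ring
      rw [e, norm_mul]
      refine mul_le_mul hμ ?_ (norm_nonneg _) hBμ0
      refine (norm_add_le _ _).trans (add_le_add ?_ ?_)
      · rw [norm_mul]
        calc ‖(tortoiseH M a (R t) : ℂ)‖ * ‖G₁ (R t)‖ ≤ 1 * B :=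
              mul_le_mul hhn hG₁B (norm_nonneg _) zero_le_one
          _ = B := one_mul B
      · rw [norm_mul]
        exact mul_le_mul hhν hG₀B (norm_nonneg _) (by positivity)
    · have e : v' t + I * ω₀ * v t = liouvilleMu M a s ω (R t) *
          ((tortoiseH M a (R t) : ℂ) * G₁ (R t) +
            ((tortoiseH M a (R t) : ℂ) * liouvilleNu M a s ω (R t) + I * (ω₀ : ℂ)) * G₀ (R t)) := by
        simp only [hv, hv']; ring
      rw [e, norm_mul]
      refine mul_le_mul hμ ?_ (norm_nonneg _) hBμ0
      refine (norm_add_le _ _).trans (add_le_add ?_ ?_)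
      · rw [norm_mul]
        exact mul_le_mul_of_nonneg_left hG₁B (norm_nonneg _)
      · rw [norm_mul]
        exact mul_le_mul_of_nonneg_left hG₀B (norm_nonneg _)
  have hbot : Tendsto (fun t => v' t + I * ω₀ * v t) atBot (𝓝 0) := by
    have hg : Tendsto (fun t => Bμ * (‖(tortoiseH M a (R t) : ℂ)‖ * B +
        ‖(tortoiseH M a (R t) : ℂ) * liouvilleNu M a s ω (R t) + I * (ω₀ : ℂ)‖ * B))
        atBot (𝓝 (Bμ * (‖(0 : ℂ)‖ * B + ‖(0 : ℂ)‖ * B))) :=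
      (((hlimh.comp hRbot).norm.mul_const B).add
        ((hlimhν.comp hRbot).norm.mul_const B)).const_mul Bμ
    rw [norm_zero, zero_mul, add_zero, mul_zero] at hg
    refine squeeze_zero_norm' ?_ hg
    filter_upwards [hnear_all] with t ht using ht.2.2
  -- FAR AWAY (`t → +∞`): bounds and the limit `v' − iω v → 0`
  have hfar_all : ∀ᶠ t in atTop, ‖v t‖ ≤ 2 * C ∧ ‖v' t‖ ≤ 2 * ((1 + C₁ + |ω|) * C) ∧
      ‖v' t - I * ω * v t‖ ≤ 2 * (C * (1 + 2 * M + C₁)) * (R t)⁻¹ := by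
    filter_upwards [hev_far] with t ht
    have hxX : X ≤ R t := hX'X.trans ht
    have hx2 : 2 * rPlus M a ≤ R t := hX'2.trans ht
    have hxa : |a| ≤ R t := hX'a.trans ht
    have hx1 : 1 ≤ R t := hX'1.trans ht
    have hr : rPlus M a < R t := by linarith
    have hx0 : 0 < R t := by linarith
    obtain ⟨hG₀C, hG₁C, hG₁₀C⟩ := hC (R t) hxX
    have hμ : ‖liouvilleMu M a s ω (R t)‖ ≤ 2 * R t ^ (1 - s) :=
      norm_liouvilleMu_le_far ha hs ω hr hxa
    have hμ0 : 0 ≤ 2 * R t ^ (1 - s) := by positivity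
    obtain ⟨hh0, hh1⟩ := tortoiseH_pos_le_one hM ha hr
    have hhn : ‖(tortoiseH M a (R t) : ℂ)‖ ≤ 1 := by
      rw [Complex.norm_real, Real.norm_eq_abs, abs_of_pos hh0]; exact hh1
    have hhνω : ‖(tortoiseH M a (R t) : ℂ) * liouvilleNu M a s ω (R t) + I * ω‖ ≤ C₁ / R t :=
      norm_tortoiseH_mul_liouvilleNu_add_le hM ha s ω hx2
    have hC₁x : C₁ / R t ≤ C₁ := div_le_self hC₁0 hx1
    have hhν : ‖(tortoiseH M a (R t) : ℂ) * liouvilleNu M a s ω (R t)‖ ≤ C₁ + |ω| := by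
      have e : (tortoiseH M a (R t) : ℂ) * liouvilleNu M a s ω (R t) =
          ((tortoiseH M a (R t) : ℂ) * liouvilleNu M a s ω (R t) + I * ω) - I * ω := by ring
      rw [e]
      refine (norm_sub_le _ _).trans (add_le_add (hhνω.trans hC₁x) ?_)
      rw [norm_mul, Complex.norm_I, one_mul, Complex.norm_real, Real.norm_eq_abs]
    have hh1n : ‖(tortoiseH M a (R t) : ℂ) - 1‖ ≤ 2 * M / R t := by
      rw [← Complex.ofReal_one, ← Complex.ofReal_sub, Complex.norm_real, Real.norm_eq_abs]
      exact abs_tortoiseH_sub_one_le hM hr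
    -- sign of `C` (from `‖G₀‖ ≤ C x^{s−1}`)
    have hC0 : 0 ≤ C := by
      have h := (norm_nonneg _).trans hG₀C
      exact le_of_mul_le_mul_right (by simpa using h) (Real.rpow_pos_of_pos hx0 _)
    refine ⟨?_, ?_, ?_⟩
    · simp only [hv, norm_mul]
      calc ‖liouvilleMu M a s ω (R t)‖ * ‖G₀ (R t)‖ ≤ (2 * R t ^ (1 - s)) * (C * R t ^ (s - 1)) :=
            mul_le_mul hμ hG₀C (norm_nonneg _) hμ0
        _ = 2 * C * (R t ^ (1 - s) * R t ^ (s - 1)) := by ring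
        _ = 2 * C := by rw [hpow1 _ hx0, mul_one]
    · have e : v' t = liouvilleMu M a s ω (R t) * ((tortoiseH M a (R t) : ℂ) * G₁ (R t) +
          ((tortoiseH M a (R t) : ℂ) * liouvilleNu M a s ω (R t)) * G₀ (R t)) := by
        simp only [hv']; ring
      rw [e, norm_mul]
      have hin : ‖(tortoiseH M a (R t) : ℂ) * G₁ (R t) +
          ((tortoiseH M a (R t) : ℂ) * liouvilleNu M a s ω (R t)) * G₀ (R t)‖ ≤
          (1 + C₁ + |ω|) * C * R t ^ (s - 1) := by
        refine (norm_add_le _ _).trans ?_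
        rw [norm_mul, norm_mul]
        calc ‖(tortoiseH M a (R t) : ℂ)‖ * ‖G₁ (R t)‖ +
              ‖(tortoiseH M a (R t) : ℂ) * liouvilleNu M a s ω (R t)‖ * ‖G₀ (R t)‖ ≤
            1 * (C * R t ^ (s - 1)) + (C₁ + |ω|) * (C * R t ^ (s - 1)) :=
              add_le_add (mul_le_mul hhn hG₁C (norm_nonneg _) zero_le_one)
                (mul_le_mul hhν hG₀C (norm_nonneg _) (by positivity))
          _ = (1 + C₁ + |ω|) * C * R t ^ (s - 1) := by ring
      calc ‖liouvilleMu M a s ω (R t)‖ * _ ≤ (2 * R t ^ (1 - s)) * ((1 + C₁ + |ω|) * C * R t ^ (s - 1)) :=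
            mul_le_mul hμ hin (norm_nonneg _) hμ0
        _ = 2 * ((1 + C₁ + |ω|) * C) * (R t ^ (1 - s) * R t ^ (s - 1)) := by ring
        _ = 2 * ((1 + C₁ + |ω|) * C) := by rw [hpow1 _ hx0, mul_one]
    · have e : v' t - I * ω * v t = liouvilleMu M a s ω (R t) *
          ((G₁ (R t) - 2 * I * ω * G₀ (R t)) + ((tortoiseH M a (R t) : ℂ) - 1) * G₁ (R t) +
            ((tortoiseH M a (R t) : ℂ) * liouvilleNu M a s ω (R t) + I * ω) * G₀ (R t)) := by
        simp only [hv, hv']; ring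
      rw [e, norm_mul]
      have hin : ‖(G₁ (R t) - 2 * I * ω * G₀ (R t)) + ((tortoiseH M a (R t) : ℂ) - 1) * G₁ (R t) +
            ((tortoiseH M a (R t) : ℂ) * liouvilleNu M a s ω (R t) + I * ω) * G₀ (R t)‖ ≤
          C * (1 + 2 * M + C₁) * R t ^ (s - 2) := by
        have h2 : ‖((tortoiseH M a (R t) : ℂ) - 1) * G₁ (R t)‖ ≤
            2 * M / R t * (C * R t ^ (s - 1)) := by
          rw [norm_mul]
          exact mul_le_mul hh1n hG₁C (norm_nonneg _) (div_nonneg (by positivity) hx0.le)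
        have h3 : ‖((tortoiseH M a (R t) : ℂ) * liouvilleNu M a s ω (R t) + I * ω) * G₀ (R t)‖ ≤
            C₁ / R t * (C * R t ^ (s - 1)) := by
          rw [norm_mul]
          exact mul_le_mul hhνω hG₀C (norm_nonneg _) (div_nonneg hC₁0 hx0.le)
        have e2 : 2 * M / R t * (C * R t ^ (s - 1)) = 2 * M * C * R t ^ (s - 2) := by
          rw [← hpow3 _ hx0]; ring
        have e3 : C₁ / R t * (C * R t ^ (s - 1)) = C₁ * C * R t ^ (s - 2) := by
          rw [← hpow3 _ hx0]; ring
        calc _ ≤ ‖G₁ (R t) - 2 * I * ω * G₀ (R t) + ((tortoiseH M a (R t) : ℂ) - 1) * G₁ (R t)‖ +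
              ‖((tortoiseH M a (R t) : ℂ) * liouvilleNu M a s ω (R t) + I * ω) * G₀ (R t)‖ :=
              norm_add_le _ _
          _ ≤ (C * R t ^ (s - 2) + 2 * M / R t * (C * R t ^ (s - 1))) +
              C₁ / R t * (C * R t ^ (s - 1)) :=
              add_le_add ((norm_add_le _ _).trans (add_le_add hG₁₀C h2)) h3
          _ = C * (1 + 2 * M + C₁) * R t ^ (s - 2) := by rw [e2, e3]; ring
      calc ‖liouvilleMu M a s ω (R t)‖ * _ ≤ (2 * R t ^ (1 - s)) * (C * (1 + 2 * M + C₁) * R t ^ (s - 2)) :=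
            mul_le_mul hμ hin (norm_nonneg _) hμ0
        _ = 2 * (C * (1 + 2 * M + C₁)) * (R t ^ (1 - s) * R t ^ (s - 2)) := by ring
        _ = 2 * (C * (1 + 2 * M + C₁)) * (R t)⁻¹ := by rw [hpow2 _ hx0]
  have htop : Tendsto (fun t => v' t - I * ω * v t) atTop (𝓝 0) := by
    have hg : Tendsto (fun t => 2 * (C * (1 + 2 * M + C₁)) * (R t)⁻¹) atTop (𝓝 0) := by
      have := (tendsto_inv_atTop_zero.comp hR.tendsto_atTop).const_mul (2 * (C * (1 + 2 * M + C₁)))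
      simpa using this
    refine squeeze_zero_norm' ?_ hg
    filter_upwards [hfar_all] with t ht using ht.2.2
  -- boundedness on the line
  have hbv : ∃ B', ∀ t, ‖v t‖ ≤ B' :=
    exists_bound_of_continuous_of_eventually hvc (hnear_all.mono fun t ht => ht.1)
      (hfar_all.mono fun t ht => ht.1)
  have hbv' : ∃ B', ∀ t, ‖v' t‖ ≤ B' :=
    exists_bound_of_continuous_of_eventually hv'c (hnear_all.mono fun t ht => ht.2.1)
      (hfar_all.mono fun t ht => ht.2.1)
  -- conclude
  have hzero : ∀ t, v t = 0 :=
    transformedSolution_eq_zero hωω₀ (fun t => (hderiv t).1) (fun t => (hderiv t).2) hode hWc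
      hint hbv hbv' hbot htop
  intro x hx
  obtain ⟨t, rfl⟩ := tortoise_exists_eq hR hx
  have h1 : liouvilleMu M a s ω (R t) * G₀ (R t) = 0 := hzero t
  rcases mul_eq_zero.1 h1 with h2 | h2
  · exact absurd h2 (liouvilleMu_ne_zero hM a s ω (hR.rPlus_lt t))
  · exact h2

end Costa2019

end Literature.Geometry.Lorentzian.Kerr

end
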